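import Summits.AtomisticToContinuum.HydrodynamicLimit.Theorems.CollisionIsometryCLTMacroClosureFvCellsProduct
import Summits.AtomisticToContinuum.HydrodynamicLimit.Theorems.CollisionIsometryCLTMacroClosureFvCubeToTorus
import Summits.AtomisticToContinuum.HydrodynamicLimit.Theorems.CollisionIsometryCLTMacroClosureFvCubeSeparation
import Summits.AtomisticToContinuum.HydrodynamicLimit.Theorems.CollisionIsometryCLTMacroClosureFvMixingParamsA
import HarnessLib

/-!
# Ruelle convexity for the tree's `limsup` free energy — the finite-`N` master inequality

Support file (`--supports stmt-AtomisticToContinuum-14870`) of the lead of the line `IdeatorTwoGen1Sketch`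
for the crux `MacroClosure`; part of the assembly of the registered stub `stub_ruelleConvexity`
(`ConvexOn ℝ (Ioo 0 (11/10)) (η ↦ η log η + η·hsExcessFreeEnergy η)`, which yields the statics input
`stub_hsFreeEnergyConvex` = item stmt-9526 by the landed transport lemma).

**The sub-cube decomposition.** For the exclusion distance `d = (η/N)^{1/3}` of `hsFreeVolume η N`, an
integer `k ≥ 2` with `s := 1/k − d > 0`, and occupation numbers `J₁ × n₁`, `J₂ × n₂`, `n₄`, `R` of the
`k³ = J₁ + J₂ + 2` closed grid cubes of side `s` centred on the grid `(1/k)ℤ³` of `𝕋³` (corridor `d`),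
with local densities `n₁η/(Ns³) ≤ η₁`, `n₂η/(Ns³) ≤ η₂`, `n₄η/(Ns³) ≤ η₂`, `Rη/(Ns³) ≤ 6/5`:

`N!/(n₁!^{J₁} n₂!^{J₂} n₄! R!) · s^{3N} · FV(η₁,n₁)^{J₁} FV(η₂,n₂)^{J₂} FV(η₂,n₄) FV(6/5,R) ≤ FV(η, N)`

(`RuelleMaster.master`, `FV = hsFreeVolume`). Ingredients, all landed by the wave-3 stub-workers of
the line: the product lower bound over separated cells with multinomial weight
(`fv_cells_product_lower`), the separation of grid cubes (`fv_cube_separation`), the comparison of a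
cube's free volume with the rescaled torus free volume (`fv_cube_to_torus`), and the monotonicity of the
free volume in the density (`HsFreeEnergyConvex.hsFreeVolume_anti`).

Reference: D. Ruelle, *Statistical Mechanics: Rigorous Results* (1969), §3.4 (here run directly on the
unit torus with a vanishing fraction of sacrificed cells, so that no existence of the thermodynamic limit
is needed for the `limsup` object).
-/

noncomputable section

open MeasureTheory Filter Set Topology
open scoped ENNReal

namespace Summit.AtomisticToContinuum.HydrodynamicLimit.Theorems.MacroClosureLine

open Literature.MathematicalPhysics.KineticTheory Literature.Analysis.FluidPDE
open Literature.Analysis.FunctionSpaces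

namespace Barycentric

namespace RuelleMaster

/-! ### Cells -/

/-- The closed grid cube `{x | ∀ l, |reprSym (x - c) l| ≤ s/2}` is measurable. -/
theorem measurableSet_cell (c : T3) (s : ℝ) :
    MeasurableSet {x : T3 | ∀ l, |Torus.reprSym (x - c) l| ≤ s / 2} := by
  have hm : Measurable fun x : T3 => Torus.reprSym (x - c) :=
    Torus.measurable_reprSym.comp (measurable_sub_const c)
  have hc : IsClosed {v : EuclideanSpace ℝ (Fin 3) | ∀ l, |v l| ≤ s / 2} := by
    have : {v : EuclideanSpace ℝ (Fin 3) | ∀ l, |v l| ≤ s / 2} =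
        ⋂ l, {v : EuclideanSpace ℝ (Fin 3) | |v l| ≤ s / 2} := by
      ext v; simp
    rw [this]
    exact isClosed_iInter fun l => isClosed_le (by fun_prop) continuous_const
  exact hc.measurableSet.preimage hm

/-! ### The free volume at exclusion distance `e` dominates `hsFreeVolume η' n` for `n e³ ≤ η'` -/

/-- For `0 ≤ e` and `n e³ ≤ η'`: `hsFreeVolume η' n ≤ vol (posDomain e n)` (monotonicity in the
density; for `n = 0` both sides are `1`). -/
theorem hsFreeVolume_le_volume_posDomain (n : ℕ) {e η' : ℝ} (he : 0 ≤ e) (h : (n : ℝ) * e ^ 3 ≤ η') :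
    hsFreeVolume η' n ≤ (volume (posDomain e n)).toReal := by
  rcases Nat.eq_zero_or_pos n with hn | hn
  · subst hn
    have huniv : posDomain e 0 = Set.univ := by
      ext x; simp only [posDomain, Set.mem_setOf_eq, Set.mem_univ, iff_true]
      intro i; exact Fin.elim0 i
    rw [huniv]
    have h1 : ((volume : Measure (Fin 0 → T3)) Set.univ).toReal = 1 := by
      have : (volume : Measure (Fin 0 → T3)) = Measure.pi fun _ => volume := rfl
      rw [this, measure_univ, ENNReal.toReal_one]
    rw [h1]
    exact hsFreeVolume_le_one η' 0
  · have hn0 : (0 : ℝ) < n := by exact_mod_cast hn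
    have hne3 : 0 ≤ (n : ℝ) * e ^ 3 := by positivity
    have hanti := HsFreeEnergyConvex.hsFreeVolume_anti hne3 h n
    refine hanti.trans (le_of_eq ?_)
    have hdens : (n : ℝ) * e ^ 3 / n = e ^ 3 := by field_simp
    have hroot : ((n : ℝ) * e ^ 3 / n) ^ (1 / 3 : ℝ) = e := by
      rw [hdens, ← Real.rpow_natCast, ← Real.rpow_mul he]
      norm_num
    rw [EosCesaro.hsFreeVolume_eq_toReal, hroot]

/-! ### The occupation profile -/

/-- The occupation profile of the `J₁ + J₂ + 1 + 1` cells: `J₁` cells with `n₁`, `J₂` cells with `n₂`,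
one cell with `n₄`, one cell with `R`. -/
theorem cnt_def (J₁ J₂ n₁ n₂ n₄ R : ℕ) :
    ∃ cnt : Fin (J₁ + J₂ + 1 + 1) → ℕ,
      (∀ f : ℕ → ℝ, ∏ m, f (cnt m) = f n₁ ^ J₁ * f n₂ ^ J₂ * f n₄ * f R) ∧
      ∑ m, cnt m = J₁ * n₁ + J₂ * n₂ + n₄ + R := by
  refine ⟨Fin.append (Fin.append (Fin.append (fun _ : Fin J₁ => n₁) (fun _ : Fin J₂ => n₂))
    (fun _ : Fin 1 => n₄)) (fun _ : Fin 1 => R), fun f => ?_, ?_⟩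
  · rw [Fin.prod_univ_add, Fin.prod_univ_add, Fin.prod_univ_add]
    simp only [Fin.append_left, Fin.append_right, Finset.prod_const, Finset.card_univ,
      Fintype.card_fin, pow_one]
  · rw [Fin.sum_univ_add, Fin.sum_univ_add, Fin.sum_univ_add]
    simp only [Fin.append_left, Fin.append_right, Finset.sum_const, Finset.card_univ,
      Fintype.card_fin, smul_eq_mul, one_mul]

/-! ### The master inequality -/

/-- **Master inequality of the sub-cube decomposition.** See the module docstring.
[cite: Ruelle1969, §3.4] -/
theorem master (η η₁ η₂ : ℝ) (N k J₁ J₂ n₁ n₂ n₄ R : ℕ) (s : ℝ) (hη : 0 < η)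
    (hN : 0 < N) (hs : s = 1 / (k : ℝ) - (η / N) ^ (1 / 3 : ℝ)) (hk : 2 ≤ k)
    (hs0 : 0 < s) (hkJ : J₁ + J₂ + 2 = k ^ 3) (hsum : J₁ * n₁ + J₂ * n₂ + n₄ + R = N)
    (h₁ : (n₁ : ℝ) * η ≤ η₁ * s ^ 3 * N) (h₂ : (n₂ : ℝ) * η ≤ η₂ * s ^ 3 * N)
    (h₄ : (n₄ : ℝ) * η ≤ η₂ * s ^ 3 * N) (hR : (R : ℝ) * η ≤ 6 / 5 * s ^ 3 * N) :
    (N.factorial : ℝ) / ((n₁.factorial : ℝ) ^ J₁ * (n₂.factorial : ℝ) ^ J₂ * n₄.factorial * R.factorial) *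
        s ^ (3 * N) * (hsFreeVolume η₁ n₁ ^ J₁ * hsFreeVolume η₂ n₂ ^ J₂ * hsFreeVolume η₂ n₄ *
          hsFreeVolume (6 / 5) R) ≤ hsFreeVolume η N := by
  -- the exclusion distance
  set d : ℝ := (η / N) ^ (1 / 3 : ℝ) with hd
  have hN0 : (0 : ℝ) < N := by exact_mod_cast hN
  have hd0 : 0 < d := Real.rpow_pos_of_pos (div_pos hη hN0) _
  have hd3 : d ^ 3 = η / N := FvMixingParams.rpow_third_pow_three _ (div_pos hη hN0).le
  have hk0 : (0 : ℝ) < k := by exact_mod_cast (lt_of_lt_of_le (by norm_num) hk)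
  have hks : (1 : ℝ) / k ≤ 1 / 2 := by
    have : (2 : ℝ) ≤ k := by exact_mod_cast hk
    exact one_div_le_one_div_of_le (by norm_num) this
  have hs12 : s < 1 / 2 := by rw [hs]; linarith
  have hdk : 2 * (d / 2) < 1 / (k : ℝ) := by rw [hs] at hs0; linarith
  -- the cells
  have hcard : Fintype.card (Fin 3 → Fin k) = J₁ + J₂ + 1 + 1 := by
    rw [Fintype.card_fun, Fintype.card_fin, Fintype.card_fin, ← hkJ]
  set e : (Fin 3 → Fin k) ≃ Fin (J₁ + J₂ + 1 + 1) := Fintype.equivFinOfCardEq hcard with he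
  set g : Fin (J₁ + J₂ + 1 + 1) → T3 :=
    fun m l => (((((e.symm m l : ℕ) : ℝ) / k : ℝ)) : UnitAddCircle) with hg
  set C : Fin (J₁ + J₂ + 1 + 1) → Set T3 :=
    fun m => {x : T3 | ∀ l, |Torus.reprSym (x - g m) l| ≤ s / 2} with hC
  obtain ⟨cnt, hprod, hcnt⟩ := cnt_def J₁ J₂ n₁ n₂ n₄ R
  -- separation of the cells
  have hsep : ∀ m ∈ (Finset.univ : Finset (Fin (J₁ + J₂ + 1 + 1))), ∀ m' ∈ (Finset.univ : Finset _),
      m ≠ m' → ∀ x ∈ C m, ∀ y ∈ C m', d ≤ Torus.euclidDist x y := by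
    intro m _ m' _ hmm x hx y hy
    have hne : e.symm m ≠ e.symm m' := fun h => hmm (e.symm.injective h)
    have hx' : ∀ l, |Torus.reprSym (x - fun l => (((((e.symm m l : ℕ) : ℝ) / k : ℝ)) : UnitAddCircle)) l|
        ≤ (1 / (k : ℝ) - 2 * (d / 2)) / 2 := by
      intro l; have := hx l; rw [hs] at this; convert this using 2; ring
    have hy' : ∀ l, |Torus.reprSym (y - fun l => (((((e.symm m' l : ℕ) : ℝ) / k : ℝ)) : UnitAddCircle)) l|
        ≤ (1 / (k : ℝ) - 2 * (d / 2)) / 2 := by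
      intro l; have := hy l; rw [hs] at this; convert this using 2; ring
    have := fv_cube_separation k (e.symm m) (e.symm m') (d / 2) x y hne (by positivity) hdk hx' hy'
    linarith
  -- the product lower bound
  have hcells := fv_cells_product_lower (Fin N) (Fin (J₁ + J₂ + 1 + 1)) Finset.univ C cnt d hd0
    (fun m _ => measurableSet_cell (g m) s) hsep (by rw [hcnt, hsum, Fintype.card_fin])
  -- the right-hand side is at most the free volume
  have hE : (volume {q : Fin N → T3 | (∀ i, ∃ j ∈ (Finset.univ : Finset (Fin (J₁ + J₂ + 1 + 1))),
      q i ∈ C j) ∧ ∀ i i', i ≠ i' → d ≤ Torus.euclidDist (q i) (q i')}).toReal ≤ hsFreeVolume η N := by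
    rw [EosCesaro.hsFreeVolume_eq_toReal]
    refine ENNReal.toReal_mono (measure_ne_top _ _) (measure_mono ?_)
    intro q hq i j hij
    exact hq.2 i j hij
  -- each cell factor dominates the rescaled torus free volume
  have hW : ∀ m, s ^ (3 * cnt m) * (volume (posDomain (d / s) (cnt m))).toReal ≤
      (volume {x : Fin (cnt m) → T3 | (∀ i, x i ∈ C m) ∧
        ∀ i i', i ≠ i' → d ≤ Torus.euclidDist (x i) (x i')}).toReal := by
    intro m
    exact fv_cube_to_torus (cnt m) (g m) s d hs0 hs12 hd0.le
  have hprodW : ∏ m, s ^ (3 * cnt m) * (volume (posDomain (d / s) (cnt m))).toReal ≤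
      ∏ m, (volume {x : Fin (cnt m) → T3 | (∀ i, x i ∈ C m) ∧
        ∀ i i', i ≠ i' → d ≤ Torus.euclidDist (x i) (x i')}).toReal :=
    Finset.prod_le_prod (fun m _ => by positivity) fun m _ => hW m
  -- the torus factors dominate the free volumes at the target densities
  have hds3 : (d / s) ^ 3 = η / (N * s ^ 3) := by rw [div_pow, hd3]; field_simp
  have hfac : ∀ (n : ℕ) (η' : ℝ), (n : ℝ) * η ≤ η' * s ^ 3 * N →
      hsFreeVolume η' n ≤ (volume (posDomain (d / s) n)).toReal := by
    intro n η' hle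
    refine hsFreeVolume_le_volume_posDomain n (div_nonneg hd0.le hs0.le) ?_
    rw [hds3]
    have hNs : 0 < (N : ℝ) * s ^ 3 := by positivity
    rw [mul_div_assoc', div_le_iff₀ hNs]
    linarith
  have hF₁ := hfac n₁ η₁ h₁
  have hF₂ := hfac n₂ η₂ h₂
  have hF₄ := hfac n₄ η₂ h₄
  have hFR := hfac R (6 / 5) hR
  -- rewrite the products along the occupation profile
  have hprod1 : ∏ m, s ^ (3 * cnt m) * (volume (posDomain (d / s) (cnt m))).toReal =
      s ^ (3 * N) * ((volume (posDomain (d / s) n₁)).toReal ^ J₁ *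
        (volume (posDomain (d / s) n₂)).toReal ^ J₂ * (volume (posDomain (d / s) n₄)).toReal *
          (volume (posDomain (d / s) R)).toReal) := by
    rw [Finset.prod_mul_distrib]
    congr 1
    · simp_rw [pow_mul]
      rw [Finset.prod_pow_eq_pow_sum, hcnt, hsum]
    · exact hprod (fun n => (volume (posDomain (d / s) n)).toReal)
  have hprod2 : (∏ m, ((cnt m).factorial : ℝ)) =
      (n₁.factorial : ℝ) ^ J₁ * (n₂.factorial : ℝ) ^ J₂ * n₄.factorial * R.factorial :=
    hprod (fun n => (n.factorial : ℝ))
  -- assemble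
  have hmult : 0 ≤ (N.factorial : ℝ) /
      ((n₁.factorial : ℝ) ^ J₁ * (n₂.factorial : ℝ) ^ J₂ * n₄.factorial * R.factorial) := by positivity
  have hnn₁ := HsFreeEnergyConvex.hsFreeVolume_nonneg η₁ n₁
  have hnn₂ := HsFreeEnergyConvex.hsFreeVolume_nonneg η₂ n₂
  have hnn₄ := HsFreeEnergyConvex.hsFreeVolume_nonneg η₂ n₄
  have hnnR := HsFreeEnergyConvex.hsFreeVolume_nonneg (6 / 5) R
  have hstep : hsFreeVolume η₁ n₁ ^ J₁ * hsFreeVolume η₂ n₂ ^ J₂ * hsFreeVolume η₂ n₄ *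
      hsFreeVolume (6 / 5) R ≤ (volume (posDomain (d / s) n₁)).toReal ^ J₁ *
        (volume (posDomain (d / s) n₂)).toReal ^ J₂ * (volume (posDomain (d / s) n₄)).toReal *
          (volume (posDomain (d / s) R)).toReal := by
    gcongr
  calc (N.factorial : ℝ) / ((n₁.factorial : ℝ) ^ J₁ * (n₂.factorial : ℝ) ^ J₂ * n₄.factorial *
          R.factorial) * s ^ (3 * N) * (hsFreeVolume η₁ n₁ ^ J₁ * hsFreeVolume η₂ n₂ ^ J₂ *
            hsFreeVolume η₂ n₄ * hsFreeVolume (6 / 5) R)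
      ≤ (N.factorial : ℝ) / ((n₁.factorial : ℝ) ^ J₁ * (n₂.factorial : ℝ) ^ J₂ * n₄.factorial *
          R.factorial) * s ^ (3 * N) * ((volume (posDomain (d / s) n₁)).toReal ^ J₁ *
            (volume (posDomain (d / s) n₂)).toReal ^ J₂ * (volume (posDomain (d / s) n₄)).toReal *
              (volume (posDomain (d / s) R)).toReal) := by
        gcongr
    _ = ((Fintype.card (Fin N)).factorial : ℝ) / (∏ m ∈ Finset.univ, ((cnt m).factorial : ℝ)) *
          ∏ m ∈ Finset.univ, s ^ (3 * cnt m) * (volume (posDomain (d / s) (cnt m))).toReal := by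
        rw [Fintype.card_fin, hprod2, hprod1, mul_assoc]
    _ ≤ ((Fintype.card (Fin N)).factorial : ℝ) / (∏ m ∈ Finset.univ, ((cnt m).factorial : ℝ)) *
          ∏ m ∈ Finset.univ, (volume {x : Fin (cnt m) → T3 | (∀ i, x i ∈ C m) ∧
            ∀ i i', i ≠ i' → d ≤ Torus.euclidDist (x i) (x i')}).toReal := by
        gcongr
    _ ≤ _ := hcells.trans hE

end RuelleMaster

/-- **Registered helper sub-goal `ruelle_master`** (the master inequality of the sub-cube decomposition,
in closed form): see `RuelleMaster.master`. [cite: Ruelle1969, §3.4] -/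
theorem ruelle_master : ∀ (η η₁ η₂ : ℝ) (N k J₁ J₂ n₁ n₂ n₄ R : ℕ) (s : ℝ), 0 < η → 0 < N → s = 1 / (k : ℝ) - (η / N) ^ (1 / 3 : ℝ) → 2 ≤ k → 0 < s → J₁ + J₂ + 2 = k ^ 3 → J₁ * n₁ + J₂ * n₂ + n₄ + R = N → (n₁ : ℝ) * η ≤ η₁ * s ^ 3 * N → (n₂ : ℝ) * η ≤ η₂ * s ^ 3 * N → (n₄ : ℝ) * η ≤ η₂ * s ^ 3 * N → (R : ℝ) * η ≤ 6 / 5 * s ^ 3 * N → (N.factorial : ℝ) / ((n₁.factorial : ℝ) ^ J₁ * (n₂.factorial : ℝ) ^ J₂ * n₄.factorial * R.factorial) * s ^ (3 * N) * (hsFreeVolume η₁ n₁ ^ J₁ * hsFreeVolume η₂ n₂ ^ J₂ * hsFreeVolume η₂ n₄ * hsFreeVolume (6 / 5) R) ≤ hsFreeVolume η N :=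
  RuelleMaster.master

end Barycentric

end Summit.AtomisticToContinuum.HydrodynamicLimit.Theorems.MacroClosureLine

end
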